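import Mathlib
import Literature.MathematicalPhysics.QuantumFieldTheory.GaugeOSData
import HarnessLib

/-!
# `ContinuumLegGivenGap` (stmt-QuantumFields-8782), line `Sketch`, reshape 6: flux-socket bookkeeping

Support file for the crux item stmt-QuantumFields-8782 (registered sub-goal `stub_fluxSocket`).

From the SEQUENTIAL uniform shape (the conclusion shape of the sibling stub `stub_alongSequence`,
taken here as a hypothesis: along any sequence of couplings with per-index torus clustering one gets
positive rates `m_k` and index-free per-pair constants) and per-`β` torus clustering above a
threshold `β₀`, produce the antecedent of the sequential socket stmt-QuantumFields-8953
(`MarginalTwistOnset.FluxGapToYangMills`) at the representation `r`: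

* couplings `β_k := max β₀ 0 + k` (so `β_k ≥ β₀`, `β_k ≥ 0`, `β_k → ∞`);
* scales `S₀(k) := max (k + 1) ⌈(m_k)⁻¹⌉₊` (so `S₀(k) → ∞` and `1 / S₀(k) ≤ m_k`);
* the single rate `m := 1` in units `1 / S₀(k)`: `e^{-m_k n} ≤ e^{-n / S₀(k)}` for `n ≥ 0`;
* per-pair constants `max C 0`, valid for every `k` (hence eventually).

Pure bookkeeping (real arithmetic and `Filter.atTop`); no definitions, no facts;
`latticeConnectedCorr` is treated as an opaque real number.
-/

namespace Summit.QuantumFields.YangMills.Theorems.ContinuumLegGivenGap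

open Filter
open Literature.MathematicalPhysics.QuantumFieldTheory

/-- **Flux-socket bookkeeping** (registered sub-goal `stub_fluxSocket` of stmt-QuantumFields-8782,
line `Sketch`, reshape 6): per-`β` torus clustering above `β₀` together with the sequential uniform
shape (index-free per-pair constants at positive rates `m_k` along any sequence of couplings, a
hypothesis) gives the antecedent of stmt-8953 at `r`, with couplings `β_k := max β₀ 0 + k`, scales
`S₀(k) := max (k + 1) ⌈(m_k)⁻¹⌉₊`, rate `1` in units `1 / S₀(k)` and per-pair constants `max C 0`,
because `n / S₀(k) ≤ m_k n`. [folklore] -/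
theorem stub_fluxSocket :
    ∀ (G : Type) [Group G] [TopologicalSpace G] [IsTopologicalGroup G] [CompactSpace G]
      [MeasurableSpace G] [BorelSpace G] (r : LatticeRep G),
      (∀ βs : ℕ → ℝ, (∀ k : ℕ, ∃ m : ℝ, 0 < m ∧ TorusClusteringAt r (βs k) m) →
        ∃ m : ℕ → ℝ, (∀ k, 0 < m k) ∧ ∀ A B : YMSpecies G, ∃ C : ℝ, ∀ k S n : ℕ, n ≤ S →
          |latticeConnectedCorr r.ρ (βs k) (2 * S + 1) A.F B.F n| ≤ C * Real.exp (-(m k * n))) →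
      (∃ β₀ : ℝ, ∀ β : ℝ, β₀ ≤ β → ∃ m : ℝ, 0 < m ∧ TorusClusteringAt r β m) →
        ∃ (β : ℕ → ℝ) (S₀ : ℕ → ℕ) (m : ℝ), 0 < m ∧ (∀ k, 0 ≤ β k) ∧ Tendsto β atTop atTop ∧
          Tendsto S₀ atTop atTop ∧ ∀ A B : YMSpecies G, ∃ K : ℝ, ∀ᶠ k in atTop, ∀ S : ℕ,
            S₀ k ≤ S → ∀ n : ℕ, n ≤ S →
              |latticeConnectedCorr r.ρ (β k) (2 * S + 1) A.F B.F n| ≤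
                K * Real.exp (-(m * n / S₀ k)) := by
  intro G _ _ _ _ _ _ r hseq hgap
  obtain ⟨β₀, hβ₀⟩ := hgap
  obtain ⟨m, hm, hpair⟩ := hseq (fun k : ℕ => max β₀ 0 + k) fun k =>
    hβ₀ _ ((le_max_left β₀ 0).trans (le_add_of_nonneg_right (Nat.cast_nonneg k)))
  refine ⟨fun k : ℕ => max β₀ 0 + k, fun k => max (k + 1) ⌈(m k)⁻¹⌉₊, 1, one_pos,
    fun k => add_nonneg (le_max_right β₀ 0) (Nat.cast_nonneg k),
    tendsto_atTop_add_const_left atTop (max β₀ 0) tendsto_natCast_atTop_atTop,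
    tendsto_atTop_mono (fun k => le_max_left _ _) (tendsto_add_atTop_nat 1), fun A B => ?_⟩
  obtain ⟨C, hC⟩ := hpair A B
  refine ⟨max C 0, Eventually.of_forall fun k S _ n hn => (hC k S n hn).trans ?_⟩
  have hexp : Real.exp (-(m k * n)) ≤
      Real.exp (-(1 * n / ((max (k + 1) ⌈(m k)⁻¹⌉₊ : ℕ) : ℝ))) := by
    refine Real.exp_le_exp.2 (neg_le_neg ?_)
    have hS₀ : (m k)⁻¹ ≤ ((max (k + 1) ⌈(m k)⁻¹⌉₊ : ℕ) : ℝ) :=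
      (Nat.le_ceil _).trans (Nat.cast_le.2 (le_max_right _ _))
    have hinv : ((max (k + 1) ⌈(m k)⁻¹⌉₊ : ℕ) : ℝ)⁻¹ ≤ m k := inv_le_of_inv_le₀ (hm k) hS₀
    calc 1 * (n : ℝ) / ((max (k + 1) ⌈(m k)⁻¹⌉₊ : ℕ) : ℝ)
        = (n : ℝ) * ((max (k + 1) ⌈(m k)⁻¹⌉₊ : ℕ) : ℝ)⁻¹ := by rw [one_mul, div_eq_mul_inv]
      _ ≤ (n : ℝ) * m k := mul_le_mul_of_nonneg_left hinv (Nat.cast_nonneg n)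
      _ = m k * n := mul_comm _ _
  calc C * Real.exp (-(m k * n))
      ≤ max C 0 * Real.exp (-(m k * n)) :=
        mul_le_mul_of_nonneg_right (le_max_left C 0) (Real.exp_pos _).le
    _ ≤ max C 0 * Real.exp (-(1 * n / ((max (k + 1) ⌈(m k)⁻¹⌉₊ : ℕ) : ℝ))) :=
        mul_le_mul_of_nonneg_left hexp (le_max_right C 0)

end Summit.QuantumFields.YangMills.Theorems.ContinuumLegGivenGap
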